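import Summits.QuantumFields.YangMills.Theorems.LuscherReductionDressedRitzPolyakovLiftPScalingAssembly
import Summits.QuantumFields.YangMills.Theorems.LuscherReductionDressedRitzPolyakovLiftPScalingDressedLevels
import Summits.QuantumFields.YangMills.Theorems.LuscherReductionDressedRitzPolyakovLiftPScalingSideConditions
import Summits.QuantumFields.YangMills.Theorems.LuscherReductionDressedRitzPolyakovLiftPScalingShell
import HarnessLib

/-!
# Route `LuscherReduction`, item `DressedRitz` (stmt-QuantumFields-20205), line «polyakovlift» r7, stub S-PSCAL″ — F9 layer D5b, part 2:
# `PScalingExistsForL (TransplantBasisLR k)` FROM THE QUASIMODE PACKAGE (fleet seat ym-20205-polyakovlift-s1 gen 3)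

Support module (`--supports stmt-QuantumFields-20205`, helper, no closure claim).  The S-PSCAL″ assembly of the line is
`PScal.pscaling_core` (LEAD, `…PolyakovLiftPScalingAssembly.lean`): at one coupling `B = 2L³/Λ³` and one raw vacuum it concludes LITERALLY the body of
`PScalingExistsForL (TransplantBasisLR k)` from (Q) a quasimode package, (D) dressed level data and (C) one constant.  (D)+(C) are
`PScal.dressed_level_data` (this seat, `…PScalingDressedLevels.lean`); (Q) is the LEAD's `quasimode_package` statement (wave-3 HANDOFF 2026-08-27T21:39Z; pen
infvol-p2), quoted below VERBATIM as the hypothesis `hQ`.  This file does the remaining quantifier bookkeeping ONCE AND FOR ALL: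

* ★★★ `pscalingExistsForL_transplantLR_of_quasimodes : (hQ : ∀ K k hkK hK F hF hFpos, ⟨quasimode package⟩) → ∀ k, PScalingExistsForL (TransplantBasisLR k)` —
  choose the cluster end `K ≥ k` (`exists_clusterEnd`), the positive AL1 family `F` (`exists_eigenfunctions_pos_groundState`), the (Q)- and (D)-constants;
  `lam0 := 1/(2(ΣM + 1))` over the ten `Λ`-type thresholds and `L0(lam) := ⌈ΣN(lam)⌉₊` over the nine `L`-type thresholds; discharge the eight side conditions
  of (Q) (`…PScalingSideConditions.lean`), the two of (D), the radius facts (`…PScalingParams.lean`); call `pscaling_core`.  The antitonicity of the one-site levels is taken as the hypothesis `hanti`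
  (`KTRCalibration.levelValue_antitone`, which lives in the route cone) so that this helper stays route-independent.

So `stub_pscaling` is `pscalingExistsForL_transplantLR_of_quasimodes quasimode_package (fun B hB => KTRCalibration.levelValue_antitone hB)` the moment (Q)
lands with the quoted statement.

HONEST FRAMING: quantifier/threshold plumbing for ONE stub of ONE conditional crux on the femto rung R2b1 (the analytic content is in the landed inputs and in
(Q)); the three RG stubs of the line stay OPEN; nothing here bears on infinite volume, the continuum limit or the Clay gap.
References: M. Lüscher, NPB 219 (1983) 233 [cite: Luscher1983, §3]; Reed–Simon IV, Thm. XIII.1 [cite: ReedSimonIV1978, Thm. XIII.1].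
-/

set_option autoImplicit false

noncomputable section

open MeasureTheory Filter Topology Real Finset
open Literature.MathematicalPhysics.QuantumFieldTheory (GaugeConfig Site gaugeTransform)
open Literature.Analysis.OperatorTheory.YMMatrixModel
open scoped BigOperators

namespace Summit.QuantumFields.YangMills.Theorems.FemtoTransferGap.PScal

open Summit.QuantumFields.YangMills.Theorems.FemtoTransferGap
open Summit.QuantumFields.YangMills.Theorems.FemtoTransferGap.PolyakovLift
open Summit.QuantumFields.YangMills.Theorems.FemtoTransferGap.ClusterInd (clusterDelta)

/-- One `Λ`-threshold out of the sum: `0 ≤ Mᵢ ≤ M`, `Λ ≥ 0`, `Λ(M+1) ≤ 1` ⟹ `Mᵢ·Λ ≤ 1`. [folklore] -/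
private theorem piece_le_one {Mi M Λ : ℝ} (hMi : Mi ≤ M) (hΛ : 0 ≤ Λ) (h : Λ * (M + 1) ≤ 1) : Mi * Λ ≤ 1 := by
  have h1 := mul_le_mul_of_nonneg_right hMi hΛ
  have e : Λ * (M + 1) = M * Λ + Λ := by ring
  linarith

/-- Nine nonnegative summands below `L` are each below `L`. [folklore] -/
private theorem le_of_sum9 {a1 a2 a3 a4 a5 a6 a7 a8 a9 L : ℝ} (h : a1 + a2 + a3 + a4 + a5 + a6 + a7 + a8 + a9 ≤ L)
    (h1 : 0 ≤ a1) (h2 : 0 ≤ a2) (h3 : 0 ≤ a3) (h4 : 0 ≤ a4) (h5 : 0 ≤ a5) (h6 : 0 ≤ a6) (h7 : 0 ≤ a7) (h8 : 0 ≤ a8) (h9 : 0 ≤ a9) :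
    a1 ≤ L ∧ a2 ≤ L ∧ a3 ≤ L ∧ a4 ≤ L ∧ a5 ≤ L ∧ a6 ≤ L ∧ a7 ≤ L ∧ a8 ≤ L ∧ a9 ≤ L := by
  refine ⟨?_, ?_, ?_, ?_, ?_, ?_, ?_, ?_, ?_⟩ <;> linarith

/-- Ten nonnegative summands are each below their sum. [folklore] -/
private theorem le_sum10 {b1 b2 b3 b4 b5 b6 b7 b8 b9 b10 : ℝ}
    (h1 : 0 ≤ b1) (h2 : 0 ≤ b2) (h3 : 0 ≤ b3) (h4 : 0 ≤ b4) (h5 : 0 ≤ b5) (h6 : 0 ≤ b6) (h7 : 0 ≤ b7) (h8 : 0 ≤ b8) (h9 : 0 ≤ b9) (h10 : 0 ≤ b10) :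
    b1 ≤ b1 + b2 + b3 + b4 + b5 + b6 + b7 + b8 + b9 + b10 ∧ b2 ≤ b1 + b2 + b3 + b4 + b5 + b6 + b7 + b8 + b9 + b10 ∧
    b3 ≤ b1 + b2 + b3 + b4 + b5 + b6 + b7 + b8 + b9 + b10 ∧ b4 ≤ b1 + b2 + b3 + b4 + b5 + b6 + b7 + b8 + b9 + b10 ∧
    b5 ≤ b1 + b2 + b3 + b4 + b5 + b6 + b7 + b8 + b9 + b10 ∧ b6 ≤ b1 + b2 + b3 + b4 + b5 + b6 + b7 + b8 + b9 + b10 ∧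
    b7 ≤ b1 + b2 + b3 + b4 + b5 + b6 + b7 + b8 + b9 + b10 ∧ b8 ≤ b1 + b2 + b3 + b4 + b5 + b6 + b7 + b8 + b9 + b10 ∧
    b9 ≤ b1 + b2 + b3 + b4 + b5 + b6 + b7 + b8 + b9 + b10 ∧ b10 ≤ b1 + b2 + b3 + b4 + b5 + b6 + b7 + b8 + b9 + b10 := by
  refine ⟨?_, ?_, ?_, ?_, ?_, ?_, ?_, ?_, ?_, ?_⟩ <;> linarith

/-- ★★★ **`PScalingExistsForL (TransplantBasisLR k)` from the quasimode package.**  The hypothesis `hQ` is the statement of the LEAD's `quasimode_package`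
verbatim (wave-3 HANDOFF); everything else (cluster end, AL1 family, (D)+(C) data, thresholds, side conditions, radii, antitone levels, `pscaling_core`) is
discharged here; `hanti` = antitonicity of the one-site levels (`KTRCalibration.levelValue_antitone`). [cite: Luscher1983, §3] [cite: ReedSimonIV1978, Thm. XIII.1] -/
theorem pscalingExistsForL_transplantLR_of_quasimodes
    (hQ : ∀ (K k : ℕ) (hkK : k ≤ K) (hK : idxLevel K < idxLevel (K + 1)) (F : Fin (K + 1) → ZM → ℝ)
      (hF : IsEigenFamily K F) (hFpos : ∀ x, 0 < F 0 x),
      ∃ A Kc CfF cQ C₁ cgap Ctop B₁ I₉ : ℝ, 0 ≤ A ∧ 0 ≤ Kc ∧ 0 ≤ CfF ∧ 0 < cQ ∧ 0 ≤ C₁ ∧ 0 < cgap ∧ 0 ≤ Ctop ∧ 0 < B₁ ∧ 0 ≤ I₉ ∧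
        ∀ (L : ℕ) (Λ : ℝ), 0 < Λ → Λ ≤ 1 / 8 → 8 ≤ L →
          B₁ ≤ 2 * (L : ℝ) ^ 3 / Λ ^ 3 → π ≤ 2 * (L : ℝ) ^ 3 / Λ ^ 3 →
          A * Real.exp (-radiusR Λ) ≤ 1 / 4 → CfF ^ 2 * I₉ * Real.exp (-radiusR Λ) ≤ 1 / 16 →
          ((K + 1 : ℕ) : ℝ) * ((24 / (L : ℝ) ^ 2 + 4 * (CfF ^ 2 * I₉) * Real.exp (-radiusR Λ)) +
              (2 * (2 * ((K + 1 : ℕ) : ℝ) * (1 + Ctop / cgap) + 1) + 1) ^ (K + 1 + 1) *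
                (((C₁ + (idxLevel (K + 1) + C₁) ^ 2 + Kc / 4) * (Λ / L) + A * Real.exp (-radiusR Λ)) / cgap +
                  2 * (2 * ((K + 1 : ℕ) : ℝ) * (1 + Ctop / cgap) + 1) * (24 / (L : ℝ) ^ 2 + 4 * (CfF ^ 2 * I₉) * Real.exp (-radiusR Λ)) ^ 2)) ≤ 1 / 2 →
          (2 * (2 * ((K + 1 : ℕ) : ℝ) * (1 + Ctop / cgap) + 1) + 1) ^ (K + 1 + 1) *
              (((C₁ + (idxLevel (K + 1) + C₁) ^ 2 + Kc / 4) * (Λ / L) + A * Real.exp (-radiusR Λ)) / cgap +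
                2 * (2 * ((K + 1 : ℕ) : ℝ) * (1 + Ctop / cgap) + 1) * (24 / (L : ℝ) ^ 2 + 4 * (CfF ^ 2 * I₉) * Real.exp (-radiusR Λ)) ^ 2) ≤ Λ ^ 2 / 4 →
          ((C₁ + (idxLevel (K + 1) + C₁) ^ 2 + Kc / 4) * (Λ / L) + A * Real.exp (-(2 / Λ))) / cgap ≤ 1 / 2 →
          (CfF / cQ) ^ 2 * Real.exp (2 * (4 * (1 / 18) * radiusR Λ ^ 4)) *
              (((C₁ + (idxLevel (K + 1) + C₁) ^ 2 + Kc / 4) * (Λ / L) + A * Real.exp (-(2 / Λ))) / cgap) ≤ Λ ^ 4 / 256 →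
          ∃ (Ψ : Fin (K + 1) → Cfg → ℝ) (θ : Fin (K + 1) → ℝ) (ε s κ Cf : ℝ),
            (Ψ 0 = fun U => radialCutoff (2 / Λ) (gnCoord (Λ / (2 * L)) U) * F 0 (gnCoord (Λ / (2 * L)) U)) ∧
            (∀ j : Fin (K + 1), 1 ≤ (j : ℕ) → Ψ j = fun U => radialCutoff (radiusR Λ) (gnCoord (Λ / (2 * L)) U) * F j (gnCoord (Λ / (2 * L)) U)) ∧
            (∀ j, IsPhys (Ψ j)) ∧ (∀ j, 0 < l2 (Ψ j) (Ψ j)) ∧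
            (∀ j, θ j * l2 (Ψ j) (Ψ j) ≤ qform su2Rep (2 * (L : ℝ) ^ 3 / Λ ^ 3) (Ψ j) (Ψ j)) ∧
            0 ≤ ε ∧ 0 ≤ s ∧ 0 ≤ κ ∧
            (∀ j j' : Fin (K + 1), j ≠ j' → |l2 (Ψ j) (Ψ j')| ≤ ε * Real.sqrt (l2 (Ψ j) (Ψ j)) * Real.sqrt (l2 (Ψ j') (Ψ j'))) ∧
            (∀ j : Fin (K + 1), 0 < levelValue su2Rep 1 (2 * (L : ℝ) ^ 3 / Λ ^ 3) (winLo j) - levelValue su2Rep 1 (2 * (L : ℝ) ^ 3 / Λ ^ 3) (winHi j)) ∧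
            (∀ j : Fin (K + 1), levelValue su2Rep 1 (2 * (L : ℝ) ^ 3 / Λ ^ 3) (winLo j) - θ j ≤
              s * (levelValue su2Rep 1 (2 * (L : ℝ) ^ 3 / Λ ^ 3) (winLo j) - levelValue su2Rep 1 (2 * (L : ℝ) ^ 3 / Λ ^ 3) (winHi j))) ∧
            (∀ j : Fin (K + 1), levelValue su2Rep 1 (2 * (L : ℝ) ^ 3 / Λ ^ 3) 0 - levelValue su2Rep 1 (2 * (L : ℝ) ^ 3 / Λ ^ 3) (winLo j) ≤
              κ * (levelValue su2Rep 1 (2 * (L : ℝ) ^ 3 / Λ ^ 3) (winLo j) - levelValue su2Rep 1 (2 * (L : ℝ) ^ 3 / Λ ^ 3) (winHi j))) ∧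
            ((K + 1 : ℕ) : ℝ) * (ε + clusterDelta (K + 1) κ ε s (K + 1)) ≤ 1 / 2 ∧
            levelValue su2Rep 1 (2 * (L : ℝ) ^ 3 / Λ ^ 3) 1 < θ 0 ∧
            0 ≤ Cf ∧ (∀ (i : Fin k) (y : ZM), |transplantFn (radiusR Λ) (fun j => F (Fin.castLE (Nat.succ_le_succ hkK) j)) i y| ≤ Cf) ∧
            clusterDelta (K + 1) κ ε s (K + 1) ≤ Λ ^ 2 / 4 ∧
            (∀ i : Fin k, Cf ^ 2 * ((levelValue su2Rep 1 (2 * (L : ℝ) ^ 3 / Λ ^ 3) 0 - θ 0) /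
                (θ 0 - levelValue su2Rep 1 (2 * (L : ℝ) ^ 3 / Λ ^ 3) 1) * l2 (Ψ 0) (Ψ 0)) ≤
              (Λ ^ 2 / 8) ^ 2 * l2 (Ψ ⟨(i : ℕ) + 1, by omega⟩) (Ψ ⟨(i : ℕ) + 1, by omega⟩)))
    (hanti : ∀ B : ℝ, 0 ≤ B → Antitone fun j => levelValue su2Rep 1 B j)
    (k : ℕ) : PScalingExistsForL (TransplantBasisLR k) := by
  classical
  obtain ⟨K, hkK, hK⟩ := exists_clusterEnd k
  obtain ⟨F, h1, h2, h3, h4, h5, hFpos⟩ := exists_eigenfunctions_pos_groundState K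
  have hF : IsEigenFamily K F := ⟨h1, h2, h3, h4, h5⟩
  obtain ⟨A, Kc, CfF, cQ, C₁, cgap, Ctop, B₁, I₉, hA, hKc, hCfF, hcQ, hC₁, hcgap, hCtop, hB₁, hI₉, hQ'⟩ :=
    hQ K k hkK hK F hF hFpos
  obtain ⟨C₀, C, B₁D, hC₀, hC, hB₁D, hD⟩ := dressed_level_data K hK
  -- keep `hK` (whose atoms `idxLevel _` are expensive for `linarith`'s atom table) boxed until the final call
  have hKbox : PLift (idxLevel K < idxLevel (K + 1)) := ⟨hK⟩
  clear hK
  -- opaque names for the level constant and the composite constants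
  have hEK1 : 0 ≤ idxLevel (K + 1) := physLevel_nonneg (by omega)
  generalize hEg : idxLevel (K + 1) = EK1 at hEK1 hQ'
  obtain ⟨N, hNdef⟩ : ∃ N : ℝ, N = ((K + 1 : ℕ) : ℝ) := ⟨_, rfl⟩
  have hN1 : 1 ≤ N := by rw [hNdef]; exact_mod_cast Nat.succ_le_succ (Nat.zero_le K)
  have hN0 : 0 ≤ N := zero_le_one.trans hN1
  obtain ⟨X, hXdef⟩ : ∃ X : ℝ, X = C₁ + (EK1 + C₁) ^ 2 + Kc / 4 := ⟨_, rfl⟩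
  have hX : 0 ≤ X := by rw [hXdef]; positivity
  obtain ⟨A', hA'def⟩ : ∃ A' : ℝ, A' = 2 * N * (1 + Ctop / cgap) + 1 := ⟨_, rfl⟩
  have hA' : 0 ≤ A' := by rw [hA'def]; positivity
  obtain ⟨P, hPdef⟩ : ∃ P : ℝ, P = (2 * A' + 1) ^ (K + 1 + 1) := ⟨_, rfl⟩
  have hP : 0 ≤ P := by rw [hPdef]; positivity
  obtain ⟨η, hηdef⟩ : ∃ η : ℝ, η = 1 / (2 * N * (1 + P * (1 + 2 * A'))) := ⟨_, rfl⟩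
  have hηden : 0 < 2 * N * (1 + P * (1 + 2 * A')) := by positivity
  have hη : 0 < η := by rw [hηdef]; positivity
  have hη1 : η ≤ 1 := by
    rw [hηdef, div_le_one hηden]
    have h1 : (1 : ℝ) ≤ 1 + P * (1 + 2 * A') := by
      have : 0 ≤ P * (1 + 2 * A') := by positivity
      linarith only [this]
    have h2 := mul_le_mul (by linarith only [hN1] : (2 : ℝ) ≤ 2 * N) h1 (by norm_num) (by linarith only [hN0])
    linarith only [h2]
  have hηN : N * (η + P * (η + 2 * A' * η)) ≤ 1 / 2 := by
    have e : N * (η + P * (η + 2 * A' * η)) = η * (2 * N * (1 + P * (1 + 2 * A'))) / 2 := by ring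
    rw [e, hηdef, div_mul_cancel₀ _ hηden.ne']
  obtain ⟨m, hmdef⟩ : ∃ m : ℝ, m = 1 / (16 * P * A' + 1) := ⟨_, rfl⟩
  have hmden : 0 < 16 * P * A' + 1 := by positivity
  have hm : 0 < m := by rw [hmdef]; positivity
  have hPA' : 0 ≤ 16 * P * A' := mul_nonneg (mul_nonneg (by norm_num : (0:ℝ) ≤ 16) hP) hA'
  have hm1 : m ≤ 1 := by rw [hmdef, div_le_one hmden]; linarith only [hPA']
  have hm16 : 16 * P * A' * m ≤ 1 := by
    rw [hmdef, ← mul_div_assoc, mul_one, div_le_one hmden]; linarith only [hPA']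
  obtain ⟨Q, hQdef⟩ : ∃ Q : ℝ, Q = CfF ^ 2 * I₉ := ⟨_, rfl⟩
  have hQ0 : 0 ≤ Q := by rw [hQdef]; positivity
  obtain ⟨G, hGdef⟩ : ∃ G : ℝ, G = (CfF / cQ) ^ 2 := ⟨_, rfl⟩
  have hG : 0 ≤ G := by rw [hGdef]; positivity
  obtain ⟨F12, hF12def⟩ : ∃ F12 : ℝ, F12 = (Nat.factorial 12 : ℝ) := ⟨_, rfl⟩
  have hF12 : 0 ≤ F12 := by rw [hF12def]; positivity
  obtain ⟨F5, hF5def⟩ : ∃ F5 : ℝ, F5 = (Nat.factorial 5 : ℝ) := ⟨_, rfl⟩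
  have hF5 : 0 ≤ F5 := by rw [hF5def]; positivity
  have hb5 : (0 : ℝ) < (14 / 9 : ℝ) ^ 5 := by positivity
  -- the ten Λ-thresholds
  obtain ⟨M2, hM2⟩ : ∃ M2 : ℝ, M2 = 4 * A * F12 := ⟨_, rfl⟩
  obtain ⟨M3, hM3⟩ : ∃ M3 : ℝ, M3 = 16 * Q * F12 := ⟨_, rfl⟩
  obtain ⟨M4, hM4⟩ : ∃ M4 : ℝ, M4 = 8 * Q * F12 / η := ⟨_, rfl⟩
  obtain ⟨M5, hM5⟩ : ∃ M5 : ℝ, M5 = 2 * A * F12 / (η * cgap) := ⟨_, rfl⟩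
  obtain ⟨M6, hM6⟩ : ∃ M6 : ℝ, M6 = 8 * Q * F12 / m := ⟨_, rfl⟩
  obtain ⟨M7, hM7⟩ : ∃ M7 : ℝ, M7 = 32 * P * A * F12 / cgap := ⟨_, rfl⟩
  obtain ⟨M8, hM8⟩ : ∃ M8 : ℝ, M8 = 2 * A / cgap := ⟨_, rfl⟩
  obtain ⟨M9, hM9⟩ : ∃ M9 : ℝ, M9 = 512 * G * A / cgap * F5 / (14 / 9 : ℝ) ^ 5 := ⟨_, rfl⟩
  have hM2n : 0 ≤ M2 := by rw [hM2]; positivity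
  have hM3n : 0 ≤ M3 := by rw [hM3]; positivity
  have hM4n : 0 ≤ M4 := by rw [hM4]; positivity
  have hM5n : 0 ≤ M5 := by rw [hM5]; positivity
  have hM6n : 0 ≤ M6 := by rw [hM6]; positivity
  have hM7n : 0 ≤ M7 := by rw [hM7]; positivity
  have hM8n : 0 ≤ M8 := by rw [hM8]; positivity
  have hM9n : 0 ≤ M9 := by rw [hM9]; positivity
  obtain ⟨Ms, hMs⟩ : ∃ Ms : ℝ, Ms = 8 + M2 + M3 + M4 + M5 + M6 + M7 + M8 + M9 + C₀ := ⟨_, rfl⟩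
  obtain ⟨h8le, hM2le, hM3le, hM4le, hM5le, hM6le, hM7le, hM8le, hM9le, hC₀le⟩ :=
    le_sum10 (by norm_num : (0:ℝ) ≤ 8) hM2n hM3n hM4n hM5n hM6n hM7n hM8n hM9n hC₀.le
  have hMs0 : 0 ≤ Ms := by rw [hMs]; linarith only [h8le]
  -- the nine L-thresholds (functions of `lam`)
  refine ⟨C, 1 / (2 * (Ms + 1)), hC, by positivity, fun lam hlam hle => ?_⟩
  obtain ⟨Ns, hNs⟩ : ∃ Ns : ℝ, Ns = 8 + B₁ + B₁D + 48 / η + 2 * X / (η * cgap) + 48 / (m * lam) + 32 * P * X / (cgap * lam) +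
      4 * X / cgap + 512 * G * X * Real.exp ((4 / 9) / lam) / (cgap * lam ^ 3) := ⟨_, rfl⟩
  refine ⟨⌈Ns⌉₊, fun L hL Λ hΛ1' hΛ2' e₀ he₀ => ?_⟩
  -- scalar facts at (lam, L, Λ)
  have hΛ : 0 < Λ := hlam.trans_le hΛ1'
  have hΛ0 : 0 ≤ Λ := hΛ.le
  have hΛMs : Λ * (Ms + 1) ≤ 1 := by
    have h2 : Λ ≤ 2 * (1 / (2 * (Ms + 1))) := hΛ2'.trans (by linarith only [hle])
    have e : 2 * (1 / (2 * (Ms + 1))) = 1 / (Ms + 1) := by field_simp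
    rw [e] at h2
    have := (le_div_iff₀ (by linarith only [hMs0] : (0:ℝ) < Ms + 1)).1 h2
    linarith only [this]
  have h8Λ : 8 * Λ ≤ 1 := piece_le_one (by rw [hMs]; exact h8le) hΛ0 hΛMs
  have hΛ8 : Λ ≤ 1 / 8 := by linarith only [h8Λ]
  have hΛ1 : Λ ≤ 1 := by linarith only [h8Λ, hΛ0]
  have hΛ2 : Λ ^ 2 ≤ 1 / 4 := by
    have := mul_le_mul hΛ8 hΛ1 hΛ0 (by norm_num)
    rw [pow_two]; linarith only [this]
  have hM2Λ : M2 * Λ ≤ 1 := piece_le_one (by rw [hMs]; exact hM2le) hΛ0 hΛMs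
  have hM3Λ : M3 * Λ ≤ 1 := piece_le_one (by rw [hMs]; exact hM3le) hΛ0 hΛMs
  have hM4Λ : M4 * Λ ≤ 1 := piece_le_one (by rw [hMs]; exact hM4le) hΛ0 hΛMs
  have hM5Λ : M5 * Λ ≤ 1 := piece_le_one (by rw [hMs]; exact hM5le) hΛ0 hΛMs
  have hM6Λ : M6 * Λ ≤ 1 := piece_le_one (by rw [hMs]; exact hM6le) hΛ0 hΛMs
  have hM7Λ : M7 * Λ ≤ 1 := piece_le_one (by rw [hMs]; exact hM7le) hΛ0 hΛMs
  have hM8Λ : M8 * Λ ≤ 1 := piece_le_one (by rw [hMs]; exact hM8le) hΛ0 hΛMs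
  have hM9Λ : M9 * Λ ≤ 1 := piece_le_one (by rw [hMs]; exact hM9le) hΛ0 hΛMs
  have hC₀Λ : Λ * C₀ ≤ 1 := by
    have := piece_le_one (Mi := C₀) (by rw [hMs]; exact hC₀le) hΛ0 hΛMs
    linarith only [this, mul_comm Λ C₀]
  -- L-facts
  have hLr : Ns ≤ L := le_trans (Nat.le_ceil Ns) (by exact_mod_cast hL)
  have hposη : 0 < η * cgap := mul_pos hη hcgap
  have hposm : 0 < m * lam := mul_pos hm hlam
  have hposc : 0 < cgap * lam := mul_pos hcgap hlam
  have hposc3 : 0 < cgap * lam ^ 3 := by positivity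
  have hN4n : 0 ≤ 48 / η := by positivity
  have hN5n : 0 ≤ 2 * X / (η * cgap) := by positivity
  have hN6n : 0 ≤ 48 / (m * lam) := by positivity
  have hN7n : 0 ≤ 32 * P * X / (cgap * lam) := by positivity
  have hN8n : 0 ≤ 4 * X / cgap := by positivity
  have hN9n : 0 ≤ 512 * G * X * Real.exp ((4 / 9) / lam) / (cgap * lam ^ 3) := by positivity
  rw [hNs] at hLr
  obtain ⟨hL8r, hLB₁, hLB₁D, hLN4, hLN5, hLN6, hLN7, hLN8, hLN9⟩ :=
    le_of_sum9 hLr (by norm_num) hB₁.le hB₁D.le hN4n hN5n hN6n hN7n hN8n hN9n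
  have hL8 : 8 ≤ L := by exact_mod_cast hL8r
  have hL1 : 1 ≤ L := le_trans (by norm_num) hL8
  have hL1r : (1 : ℝ) ≤ L := by exact_mod_cast hL1
  have hL0r : (0 : ℝ) < L := by linarith only [hL1r]
  -- `L ≤ 2L³`
  have hL2L3 : (L : ℝ) ≤ 2 * (L : ℝ) ^ 3 := by
    have h1 : (1 : ℝ) ≤ (L : ℝ) ^ 2 := one_le_pow₀ hL1r
    have h2 : (L : ℝ) * 1 ≤ (L : ℝ) * (L : ℝ) ^ 2 := mul_le_mul_of_nonneg_left h1 hL0r.le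
    have e : (L : ℝ) * (L : ℝ) ^ 2 = (L : ℝ) ^ 3 := by ring
    have h3 : 0 ≤ (L : ℝ) ^ 3 := by positivity
    linarith only [h2, e, h3]
  -- (S1), (S2) and the (D) coupling threshold
  have hS1 : B₁ ≤ 2 * (L : ℝ) ^ 3 / Λ ^ 3 := le_coupling_of_le hΛ hΛ1 (hLB₁.trans hL2L3)
  have hSD : B₁D ≤ 2 * (L : ℝ) ^ 3 / Λ ^ 3 := le_coupling_of_le hΛ hΛ1 (hLB₁D.trans hL2L3)
  have hS2 : π ≤ 2 * (L : ℝ) ^ 3 / Λ ^ 3 := by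
    refine le_coupling_of_le hΛ hΛ1 ?_
    have : π ≤ 4 := Real.pi_le_four
    linarith only [this, hL8r, hL2L3]
  -- (S3), (S4)
  have hS3 : A * Real.exp (-radiusR Λ) ≤ 1 / 4 := by
    refine sc_exp_radius hA hΛ hΛ1 ?_
    rw [← hF12def]
    have e : M2 * Λ = 4 * (A * F12 * Λ) := by rw [hM2]; ring
    linarith only [e, hM2Λ]
  have hS4 : CfF ^ 2 * I₉ * Real.exp (-radiusR Λ) ≤ 1 / 16 := by
    rw [← hQdef]
    refine sc_exp_radius hQ0 hΛ hΛ1 ?_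
    rw [← hF12def]
    have e : M3 * Λ = 16 * (Q * F12 * Λ) := by rw [hM3]; ring
    linarith only [e, hM3Λ]
  -- εb ≤ η and εb ≤ mΛ; sb ≤ η and P·sb ≤ Λ²/16
  have hεη : 24 / (L : ℝ) ^ 2 + 4 * (CfF ^ 2 * I₉) * Real.exp (-radiusR Λ) ≤ η := by
    rw [← hQdef]
    refine sc_epsb hL1 ?_ ?_
    · have := (div_le_iff₀ hη).1 hLN4
      linarith only [this]
    · refine sc_exp_radius (by positivity) hΛ hΛ1 ?_
      rw [← hF12def]
      have e0 : M4 * η = 8 * Q * F12 := by rw [hM4]; exact div_mul_cancel₀ _ hη.ne'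
      have e : η * (M4 * Λ) = 2 * (4 * Q * F12 * Λ) := by
        have : η * (M4 * Λ) = (M4 * η) * Λ := by ring
        rw [this, e0]; ring
      have h1 : η * (M4 * Λ) ≤ η * 1 := mul_le_mul_of_nonneg_left hM4Λ hη.le
      linarith only [e, h1]
  have hεm : 24 / (L : ℝ) ^ 2 + 4 * (CfF ^ 2 * I₉) * Real.exp (-radiusR Λ) ≤ m * Λ := by
    rw [← hQdef]
    refine sc_epsb hL1 ?_ ?_
    · have h1 := (div_le_iff₀ hposm).1 hLN6
      have h2 : m * lam * L ≤ m * Λ * L :=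
        mul_le_mul_of_nonneg_right (mul_le_mul_of_nonneg_left hΛ1' hm.le) hL0r.le
      linarith only [h1, h2]
    · have h := sc_exp_radius_sq (P := 4 * Q) (c := m / 2) (by positivity) hΛ hΛ1 (by
        rw [← hF12def]
        have e0 : M6 * m = 8 * Q * F12 := by rw [hM6]; exact div_mul_cancel₀ _ hm.ne'
        have e : m * (M6 * Λ) = 2 * (4 * Q * F12 * Λ) := by
          have : m * (M6 * Λ) = (M6 * m) * Λ := by ring
          rw [this, e0]; ring
        have h1 : m * (M6 * Λ) ≤ m * 1 := mul_le_mul_of_nonneg_left hM6Λ hm.le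
        linarith only [e, h1])
      have h2 : m / 2 * Λ ^ 2 ≤ m * Λ / 2 := by
        have h3 : Λ ^ 2 ≤ Λ := by rw [pow_two]; exact mul_le_of_le_one_left hΛ0 hΛ1
        have h4 := mul_le_mul_of_nonneg_left h3 (by linarith only [hm.le] : 0 ≤ m / 2)
        linarith only [h4]
      linarith only [h, h2]
  have hεb0 : 0 ≤ 24 / (L : ℝ) ^ 2 + 4 * (CfF ^ 2 * I₉) * Real.exp (-radiusR Λ) := by positivity
  have hsbη : ((C₁ + (EK1 + C₁) ^ 2 + Kc / 4) * (Λ / L) + A * Real.exp (-radiusR Λ)) / cgap ≤ η := by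
    rw [← hXdef]
    refine sc_sb hcgap ?_ ?_
    · refine sc_mul_div_le hX hL0r hΛ1 ?_
      have h1 := (div_le_iff₀ hposη).1 hLN5
      rw [div_le_iff₀ hL0r]
      linarith only [h1]
    · refine sc_exp_radius hA hΛ hΛ1 ?_
      rw [← hF12def]
      have e0 : M5 * (η * cgap) = 2 * A * F12 := by rw [hM5]; exact div_mul_cancel₀ _ hposη.ne'
      have e : (η * cgap) * (M5 * Λ) = 2 * (A * F12 * Λ) := by
        have : (η * cgap) * (M5 * Λ) = (M5 * (η * cgap)) * Λ := by ring
        rw [this, e0]; ring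
      have h1 : (η * cgap) * (M5 * Λ) ≤ (η * cgap) * 1 := mul_le_mul_of_nonneg_left hM5Λ hposη.le
      linarith only [e, h1]
  have hsbP : P * (((C₁ + (EK1 + C₁) ^ 2 + Kc / 4) * (Λ / L) + A * Real.exp (-radiusR Λ)) / cgap) ≤ Λ ^ 2 / 16 := by
    rw [← hXdef]
    by_cases hP0 : P = 0
    · rw [hP0, zero_mul]; positivity
    have hPpos : 0 < P := lt_of_le_of_ne hP (Ne.symm hP0)
    have hsb : (X * (Λ / L) + A * Real.exp (-radiusR Λ)) / cgap ≤ Λ ^ 2 / (16 * P) := by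
      refine sc_sb hcgap ?_ ?_
      · -- `X(Λ/L) ≤ (lam cgap/(32P))·Λ ≤ Λ² cgap/(32P)`
        have h1 := (div_le_iff₀ hposc).1 hLN7
        have hu : X / L ≤ lam * cgap / (32 * P) := by
          rw [div_le_iff₀ hL0r, div_mul_eq_mul_div, le_div_iff₀ (by positivity)]
          linarith only [h1]
        have h2 := sc_mul_div_le_mul hΛ0 hu
        have h3 : lam * cgap / (32 * P) * Λ ≤ Λ * cgap / (32 * P) * Λ := by
          have := div_le_div_of_nonneg_right (mul_le_mul_of_nonneg_right hΛ1' hcgap.le) (by positivity : (0:ℝ) ≤ 32 * P)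
          exact mul_le_mul_of_nonneg_right this hΛ0
        have e : Λ * cgap / (32 * P) * Λ = Λ ^ 2 / (16 * P) * cgap / 2 := by field_simp; ring
        linarith only [h2, h3, e]
      · have h := sc_exp_radius_sq (P := A) (c := cgap / (32 * P)) hA hΛ hΛ1 (by
          rw [← hF12def]
          have e0 : M7 * cgap = 32 * P * A * F12 := by rw [hM7]; exact div_mul_cancel₀ _ hcgap.ne'
          have e : cgap * (M7 * Λ) = 32 * P * (A * F12 * Λ) := by
            have : cgap * (M7 * Λ) = (M7 * cgap) * Λ := by ring
            rw [this, e0]; ring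
          have h1 : cgap * (M7 * Λ) ≤ cgap * 1 := mul_le_mul_of_nonneg_left hM7Λ hcgap.le
          rw [le_div_iff₀ (by positivity)]
          linarith only [e, h1])
        have e : cgap / (32 * P) * Λ ^ 2 = Λ ^ 2 / (16 * P) * cgap / 2 := by field_simp; ring
        linarith only [h, e]
    have h5 := mul_le_mul_of_nonneg_left hsb hP
    have e : P * (Λ ^ 2 / (16 * P)) = Λ ^ 2 / 16 := by field_simp
    linarith only [h5, e]
  -- (S5), (S6)
  have hS5 := sc_five (εb := 24 / (L : ℝ) ^ 2 + 4 * (CfF ^ 2 * I₉) * Real.exp (-radiusR Λ))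
    (sb := ((C₁ + (EK1 + C₁) ^ 2 + Kc / 4) * (Λ / L) + A * Real.exp (-radiusR Λ)) / cgap)
    hN0 hP hA' hη1 hηN hεb0 hεη hsbη
  have hS6 := sc_six (εb := 24 / (L : ℝ) ^ 2 + 4 * (CfF ^ 2 * I₉) * Real.exp (-radiusR Λ))
    (sb := ((C₁ + (EK1 + C₁) ^ 2 + Kc / 4) * (Λ / L) + A * Real.exp (-radiusR Λ)) / cgap)
    hP hA' hm.le hm1 hm16 hεb0 hεm hsbP
  -- (S7)
  have hXL : (C₁ + (EK1 + C₁) ^ 2 + Kc / 4) * (Λ / L) ≤ cgap / 4 := by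
    rw [← hXdef]
    refine sc_mul_div_le hX hL0r hΛ1 ?_
    have h1 := (div_le_iff₀ hcgap).1 hLN8
    rw [div_le_iff₀ hL0r]
    linarith only [h1]
  have hA2 : A * Real.exp (-(2 / Λ)) ≤ cgap / 4 := by
    refine sc_exp_two hA (by positivity) hΛ ?_
    have e0 : M8 * cgap = 2 * A := by rw [hM8]; exact div_mul_cancel₀ _ hcgap.ne'
    have e : cgap * (M8 * Λ) = 2 * (A * Λ) := by
      have : cgap * (M8 * Λ) = (M8 * cgap) * Λ := by ring
      rw [this, e0]; ring
    have h1 : cgap * (M8 * Λ) ≤ cgap * 1 := mul_le_mul_of_nonneg_left hM8Λ hcgap.le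
    linarith only [e, h1]
  have hS7 := sc_seven (L := (L : ℝ)) hcgap hXL hA2
  -- (S8)
  have hS8 : (CfF / cQ) ^ 2 * Real.exp (2 * (4 * (1 / 18) * radiusR Λ ^ 4)) *
      (((C₁ + (EK1 + C₁) ^ 2 + Kc / 4) * (Λ / L) + A * Real.exp (-(2 / Λ))) / cgap) ≤ Λ ^ 4 / 256 := by
    rw [← hXdef, ← hGdef]
    refine sc_eight hΛ ?_ ?_
    · exact sc_eight_L hG hX hcgap hlam hΛ1' (by omega) hLN9
    · refine sc_eight_Λ hG hA hcgap hΛ ?_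
      rw [← hF5def]
      have e0 : M9 * (14 / 9 : ℝ) ^ 5 = 512 * G * A / cgap * F5 := by rw [hM9]; exact div_mul_cancel₀ _ hb5.ne'
      have e : (14 / 9 : ℝ) ^ 5 * (M9 * Λ) = 512 * G * A / cgap * F5 * Λ := by
        have : (14 / 9 : ℝ) ^ 5 * (M9 * Λ) = (M9 * (14 / 9 : ℝ) ^ 5) * Λ := by ring
        rw [this, e0]
      have h1 : (14 / 9 : ℝ) ^ 5 * (M9 * Λ) ≤ (14 / 9 : ℝ) ^ 5 * 1 := mul_le_mul_of_nonneg_left hM9Λ hb5.le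
      linarith only [e, h1]
  -- the (Q) block
  obtain ⟨Ψ, θ, ε, s, κ, Cf, hΨ0, hΨsucc, hΨphys, hΨpos, hθ, hε, hs, hκ, hgram, hgap, hsj, hκj, hsmall, hθ0, hCf0, hCf, hδ,
    hηsmall⟩ := hQ' L Λ hΛ hΛ8 hL8 hS1 hS2 hS3 hS4 (by rw [← hNdef, ← hA'def, ← hPdef]; exact hS5)
      (by rw [← hNdef, ← hA'def, ← hPdef]; exact hS6) hS7 hS8
  -- the (D)+(C) block
  obtain ⟨σ, lamlow, Γ, τ, hσ, hlow0, hlow, hΓ, hτ0, hτ1, hup, hlo', hgapτ, hτC, hΩC⟩ :=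
    hD k hkK (2 * (L : ℝ) ^ 3 / Λ ^ 3) hSD L hL1 Λ hΛ hC₀Λ (bareLambda_scaledCoupling hΛ hL1)
  -- radii, antitone levels, and the core
  have hR1 : 1 ≤ radiusR Λ := one_le_radiusR hΛ hΛ1
  have hR4 : 1 ≤ radiusR Λ ^ 4 * Λ := le_of_eq (radiusR_pow_four_mul hΛ).symm
  have hRΛ : radiusR Λ * Λ ≤ 1 / 4 := radiusR_mul_le hΛ hΛ8
  have hRRv : Real.sqrt 2 * radiusR Λ ≤ 2 / Λ := sqrt_two_mul_radiusR_le hΛ hΛ1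
  have hRvΛ : Real.sqrt 2 * (2 / Λ) * Λ < π := sqrt_two_mul_radiusV_mul_lt_pi hΛ
  have hantiB : Antitone fun j => levelValue su2Rep 1 (2 * (L : ℝ) ^ 3 / Λ ^ 3) j :=
    hanti _ (coupling_pos hΛ (by omega)).le
  exact pscaling_core hkK hKbox.down hF hFpos hL1 hΛ hΛ2 hR1 hR4 hRΛ hRRv hRvΛ rfl hantiB Ψ hΨ0 hΨsucc hΨphys hΨpos hθ hε hs hκ
    hgram hgap hsj hκj hsmall hθ0 hCf0 hCf hδ hηsmall hσ hlow0 hlow hΓ hτ0 hτ1 hup hlo' hgapτ hτC hΩC e₀ he₀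

end Summit.QuantumFields.YangMills.Theorems.FemtoTransferGap.PScal

end
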